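import Mathlib.RingTheory.Ideal.AssociatedPrime.Localization
import Mathlib.RingTheory.QuotSMulTop
import Mathlib.RingTheory.Nakayama
import Literature.NumberTheory.EllipticCurves.IwasawaAlgebraPseudoNullProofs
import Literature.NumberTheory.EllipticCurves.Rubin1991.TwoVariableMainConjecture
import Summits.BirchSwinnertonDyer.BirchSwinnertonDyer.Theorems.EisensteinPrimesTwoVariablePseudoNull
import HarnessLib

/-!
# No pseudo-null submodule from ONE line: `X[ℓ] = 0` and `X ⧸ ℓX` without finite submodules
# (helper for crux stmt-BirchSwinnertonDyer-20368 `PrintCf2.SplitBadTwoRankOneOfFacts`, stub S3n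
# `stub_noPseudoNull_two` of skeleton v10.4/v10.5; cell `bsd-print-cf2`, seat `bsd-line-cf2-p1-w7` g4)

Pure commutative algebra, Theses-free.  The registered stub S3n asks that the two-variable dual
`D.X` (a finitely generated torsion module over `Λ₂ = ℤ₂⟦T₂⟧⟦T₁⟧ = IwasawaAlgebra₂ 2`) has no
non-zero pseudo-null submodule.  This file REDUCES that two-variable statement to two ONE-variable
statements along a single line `ℓ` (for the skeleton: `ℓ = T₁`, the OUTER variable, whose quotient
`Λ₂/T₁ = Λ` is the adapted line `K*_∞` of v10.4; or `ℓ = C T₂`, the inner variable):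

**Main theorem** (`noPseudoNull_of_regular_of_noFiniteSubmodule`, and its instances
`noPseudoNull_of_X_regular_of_noFiniteSubmodule` / `noPseudoNull_of_CX_regular_of_noFiniteSubmodule`).
Let `X` be a finitely generated `Λ₂`-module, `ℓ ∈ 𝔪_{Λ₂}` with
* (REG) `ℓ` is `X`-regular: `ℓ • x = 0 → x = 0`;
* (NF)  `X ⧸ ℓX` (`QuotSMulTop ℓ X`) has no non-zero FINITE `Λ₂`-submodule.
Then every pseudo-null `Λ₂`-submodule of `X` is `⊥`.

Proof (generic over a Noetherian ring `R`, §1–§3; `Λ₂` enters only in §4 through `dim Λ₂ = 3`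
and the finiteness of `Λ₂/𝔪ⁿ`): pseudo-nullity of a submodule is a pointwise condition
(`isPseudoNull_submodule_iff`), so the pseudo-null submodules are closed under `⊔` and a Noetherian
module has a LARGEST one, `N₀` (`exists_isPseudoNull_forall_le`); (REG) passes to `X/N₀`
(`mem_of_smul_mem_of_forall_le`: if `ℓx ∈ N₀` then `x ∈ N₀`), so `N₀ ⊓ ℓX = ℓN₀` and
`N₀/ℓN₀ ↪ X/ℓX`; for a prime `𝔭 ∋ ℓ` of height `≤ 2`, `(N₀)_𝔭 = 0` — otherwise `𝔭` is minimal
over `Ann N₀` (pseudo-nullity pushes every prime over `Ann N₀` to height `≥ 2`), hence ASSOCIATED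
to `N₀` (Mathlib `minimalPrimes_annihilator_subset_associatedPrimes`), hence `𝔭 = Ann(y)` with
`ℓy = 0`, `y ≠ 0`, contradicting (REG) (`exists_smul_eq_zero_of_height_le_two`); so the image of
`N₀` in `X/ℓX` is supported in height `≥ 3`, i.e. (over `Λ₂`) at `𝔪` only, i.e. FINITE
(`finite_of_forall_height_le_two`); (NF) kills it, so `N₀ ≤ ℓX`, so `N₀ = ℓN₀`, so `N₀ = 0` by
Nakayama (`eq_bot_of_isPseudoNull_of_regular`).

USE for S3n (road map, not proved here): with `ℓ = T₁` adapted (`γ₁` topologically generating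
`Gal(K̃_∞/K*_∞)`), (REG) is `(H¹_nr(K̃_∞, A_θ))_{γ₁} = 0` and (NF) is «`(H¹_nr(K̃_∞, A_θ))^{γ₁=1}`
has no proper finite-index `Λ`-submodule» — one-variable statements over the line `K*_∞` of the
shape of the cell's B17 files (`…RestrictedSelmerNoFiniteSubmoduleOf*`) and of X11b's procyclic
descent.  The converse direction used by the skeleton (S3n ⇒ `X[T₁] = 0` for `T₁` coprime to
`ch X`) is the tree's `TwoVarSpecialization.torsionBy_X_eq_bot_of_noPseudoNull` (-w4 g10).

HONEST FRAMING: generic algebra; closes nothing by itself (`--supports`).  No named fact, no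
`sorry`.  No summit statement is proved by this file; BSD is not proved by any of this.

References: Bourbaki, *Algèbre commutative* VII §4.4 (pseudo-null modules), IV §1 (associated
primes; Prop. 7: minimal primes of the support are associated); Neukirch–Schmidt–Wingberg,
*Cohomology of Number Fields* (2008) V §1 (5.1.4); Matsumura, *Commutative Ring Theory* Thm. 6.5.
-/

-- the summit namespace `Summit.BirchSwinnertonDyer.BirchSwinnertonDyer` repeats the problem name by design (D-0017)
set_option linter.dupNamespace false
set_option autoImplicit false

noncomputable section

open scoped Pointwise
open IsLocalRing Literature.NumberTheory.EllipticCurves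

namespace Summit.BirchSwinnertonDyer.BirchSwinnertonDyer.Theorems.PrintCf2.NoPseudoNullOfLine

/-! ## §1. Pseudo-null submodules: pointwise criterion, sums, the largest one, regularity -/

section Generic

variable {R : Type*} [CommRing R] {X : Type*} [AddCommGroup X] [Module R X]

/-- Pointwise form of pseudo-nullity: `M` is pseudo-null iff every element is killed by some
element outside each prime of height `≤ 1` (`M_𝔭 = 0` elementwise).
(Bourbaki AC VII §4.4 Def. 2.) [folklore] -/
theorem isPseudoNull_iff_forall_exists (M : Type*) [AddCommGroup M] [Module R M] :
    Module.IsPseudoNull R M ↔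
      ∀ 𝔭 : PrimeSpectrum R, 𝔭.asIdeal.height ≤ 1 → ∀ m : M, ∃ r ∉ 𝔭.asIdeal, r • m = 0 := by
  refine forall₂_congr fun 𝔭 _ ↦ ?_
  rw [LocalizedModule.subsingleton_iff]
  exact forall_congr' fun m ↦ Iff.rfl

/-- Pointwise form of pseudo-nullity for a submodule `N ≤ X`: every `x ∈ N` is killed by some
element outside each prime of height `≤ 1`. [folklore] -/
theorem isPseudoNull_submodule_iff (N : Submodule R X) :
    Module.IsPseudoNull R N ↔
      ∀ 𝔭 : PrimeSpectrum R, 𝔭.asIdeal.height ≤ 1 → ∀ x ∈ N, ∃ r ∉ 𝔭.asIdeal, r • x = 0 := by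
  rw [isPseudoNull_iff_forall_exists]
  refine forall₂_congr fun 𝔭 _ ↦ ⟨fun h x hx ↦ ?_, fun h x ↦ ?_⟩
  · obtain ⟨r, hr, h0⟩ := h ⟨x, hx⟩
    exact ⟨r, hr, by simpa using congrArg Subtype.val h0⟩
  · obtain ⟨r, hr, h0⟩ := h x x.2
    exact ⟨r, hr, Subtype.ext (by simpa using h0)⟩

/-- The zero submodule is pseudo-null. [folklore] -/
theorem isPseudoNull_bot : Module.IsPseudoNull R (⊥ : Submodule R X) :=
  Module.isPseudoNull_of_subsingleton R _

/-- The sum of two pseudo-null submodules is pseudo-null (the pointwise criterion: if `r ∉ 𝔭`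
kills `y` and `s ∉ 𝔭` kills `z` then `sr ∉ 𝔭` kills `y + z`).
(Bourbaki AC VII §4.4: pseudo-null modules form a Serre subcategory.) [folklore] -/
theorem isPseudoNull_sup {N₁ N₂ : Submodule R X} (h₁ : Module.IsPseudoNull R N₁)
    (h₂ : Module.IsPseudoNull R N₂) : Module.IsPseudoNull R ↥(N₁ ⊔ N₂) := by
  rw [isPseudoNull_submodule_iff] at h₁ h₂ ⊢
  intro 𝔭 h𝔭 x hx
  obtain ⟨y, hy, z, hz, rfl⟩ := Submodule.mem_sup.mp hx
  obtain ⟨r, hr, hry⟩ := h₁ 𝔭 h𝔭 y hy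
  obtain ⟨s, hs, hsz⟩ := h₂ 𝔭 h𝔭 z hz
  refine ⟨s * r, fun h ↦ (𝔭.isPrime.mem_or_mem h).elim hs hr, ?_⟩
  rw [smul_add, mul_smul, hry, smul_zero, zero_add, mul_comm, mul_smul, hsz, smul_zero]

/-- **The largest pseudo-null submodule.** A Noetherian module has a pseudo-null submodule `N₀`
containing every pseudo-null submodule (a maximal one exists by the Noetherian condition, and it
absorbs every other one by `isPseudoNull_sup`).
(Bourbaki AC VII §4.4; NSW (5.1.4): "the maximal pseudo-null submodule".) [folklore] -/
theorem exists_isPseudoNull_forall_le [IsNoetherian R X] :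
    ∃ N₀ : Submodule R X, Module.IsPseudoNull R N₀ ∧
      ∀ N : Submodule R X, Module.IsPseudoNull R N → N ≤ N₀ := by
  obtain ⟨N₀, hN₀, hmax⟩ := set_has_maximal_iff_noetherian.mpr ‹IsNoetherian R X›
    {N : Submodule R X | Module.IsPseudoNull R N} ⟨⊥, isPseudoNull_bot⟩
  refine ⟨N₀, hN₀, fun N hN ↦ ?_⟩
  have hsup : Module.IsPseudoNull R ↥(N ⊔ N₀) := isPseudoNull_sup hN hN₀
  have heq : N₀ = N ⊔ N₀ := eq_of_le_of_not_lt le_sup_right (hmax _ hsup)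
  exact le_sup_left.trans_eq heq.symm

/-- **Regularity passes to the quotient by the largest pseudo-null submodule**: if `ℓ` is
`X`-regular and `N₀` is the largest pseudo-null submodule, then `ℓ • x ∈ N₀` forces `x ∈ N₀`
(the cyclic module `R ∙ x` is pseudo-null: `s ∉ 𝔭` with `s ℓ x = 0` gives `ℓ (s x) = 0`, so
`s x = 0`). [folklore] -/
theorem mem_of_smul_mem_of_forall_le {ℓ : R} (hℓ : ∀ x : X, ℓ • x = 0 → x = 0)
    {N₀ : Submodule R X} (hN₀ : Module.IsPseudoNull R N₀)
    (hmax : ∀ N : Submodule R X, Module.IsPseudoNull R N → N ≤ N₀) {x : X} (hx : ℓ • x ∈ N₀) :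
    x ∈ N₀ := by
  have hPN : Module.IsPseudoNull R ↥(R ∙ x) := by
    rw [isPseudoNull_submodule_iff] at hN₀ ⊢
    intro 𝔭 h𝔭 y hy
    obtain ⟨a, rfl⟩ := Submodule.mem_span_singleton.mp hy
    obtain ⟨s, hs, h0⟩ := hN₀ 𝔭 h𝔭 _ hx
    refine ⟨s, hs, ?_⟩
    have hsx : s • x = 0 := hℓ _ (by rw [smul_comm, h0])
    rw [smul_comm, hsx, smul_zero]
  exact hmax _ hPN (Submodule.mem_span_singleton_self x)

/-! ## §2. The image of a pseudo-null submodule modulo a regular element lives in height `≥ 3` -/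

variable [IsNoetherianRing R]

/-- **Codimension-two vanishing.** Let `X` be finitely generated over a Noetherian ring, `ℓ`
`X`-regular, `N ≤ X` pseudo-null, and `𝔭 ∋ ℓ` a prime of height `≤ 2`.  Then `N_𝔭 = 0`
(pointwise): otherwise `Ann N ≤ 𝔭`, a minimal prime `𝔮 ≤ 𝔭` over `Ann N` has height `≥ 2`
(pseudo-nullity), so `𝔮 = 𝔭`; but minimal primes over the annihilator are associated
(Mathlib `minimalPrimes_annihilator_subset_associatedPrimes`), so `𝔭 = Ann(y)` for some `y ∈ N`,
and `ℓ ∈ 𝔭` gives `ℓ y = 0`, `y = 0`, `𝔭 = ⊤` — absurd.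
(Bourbaki AC IV §1 Prop. 7; Matsumura Thm. 6.5.) [folklore] -/
theorem exists_smul_eq_zero_of_height_le_two [Module.Finite R X] {ℓ : R}
    (hℓ : ∀ x : X, ℓ • x = 0 → x = 0) {N : Submodule R X} (hN : Module.IsPseudoNull R N)
    {𝔭 : PrimeSpectrum R} (h𝔭 : 𝔭.asIdeal.height ≤ 2) (hℓ𝔭 : ℓ ∈ 𝔭.asIdeal) :
    ∀ x ∈ N, ∃ r ∉ 𝔭.asIdeal, r • x = 0 := by
  haveI : IsNoetherian R X := isNoetherian_of_isNoetherianRing_of_finite R X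
  by_cases hJ : Module.annihilator R N ≤ 𝔭.asIdeal
  swap
  · obtain ⟨r, hrJ, hr𝔭⟩ := Set.not_subset.mp hJ
    intro x hx
    refine ⟨r, hr𝔭, ?_⟩
    simpa using congrArg Subtype.val (Module.mem_annihilator.mp hrJ ⟨x, hx⟩)
  · exfalso
    obtain ⟨𝔮, h𝔮min, h𝔮𝔭⟩ := Ideal.exists_minimalPrimes_le hJ
    have h𝔮ass : 𝔮 ∈ associatedPrimes R N :=
      Module.associatedPrimes.minimalPrimes_annihilator_subset_associatedPrimes R N h𝔮min
    haveI h𝔮prime : 𝔮.IsPrime := h𝔮min.1.1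
    -- `𝔮` has height `≥ 2`
    have h𝔮2 : ¬ 𝔮.height ≤ 1 := by
      intro h1
      have hsub := hN ⟨𝔮, h𝔮prime⟩ h1
      have hmem : (⟨𝔮, h𝔮prime⟩ : PrimeSpectrum R) ∈ Module.support R N :=
        Module.mem_support_iff_of_finite.2 h𝔮min.1.2
      exact Module.notMem_support_iff.2 hsub hmem
    -- hence `𝔮 = 𝔭`
    have h𝔮eq : 𝔮 = 𝔭.asIdeal := by
      by_contra hne
      have hlt : 𝔮 < 𝔭.asIdeal := lt_of_le_of_ne h𝔮𝔭 hne
      have h3 : 𝔮.height + 1 ≤ 1 + 1 := by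
        rw [one_add_one_eq_two]
        exact (Ideal.height_add_one_le_of_lt_of_isPrime hlt).trans h𝔭
      exact h𝔮2 ((WithTop.add_le_add_iff_right WithTop.one_ne_top).1 h3)
    -- `ℓ ∈ 𝔮 = Ann(y)` with `y ≠ 0`
    obtain ⟨-, y, hy⟩ := (isAssociatedPrime_iff).mp h𝔮ass
    have hℓ𝔮 : ℓ ∈ 𝔮 := by rw [h𝔮eq]; exact hℓ𝔭
    rw [hy, Submodule.mem_colon_singleton, Submodule.mem_bot] at hℓ𝔮
    have hy0 : y = 0 := Subtype.ext (hℓ _ (by simpa using congrArg Subtype.val hℓ𝔮))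
    apply h𝔮prime.ne_top
    rw [hy, Ideal.eq_top_iff_one, Submodule.mem_colon_singleton, hy0, smul_zero]
    exact Submodule.zero_mem _

/-! ## §3. The reduction theorem over a Noetherian ring -/

/-- **No pseudo-null submodule from one line (generic form).** `R` Noetherian, `X` finitely
generated, `ℓ` in the Jacobson radical and `X`-regular.  If every submodule `Q` of `X ⧸ ℓX`
supported in height `≥ 3` (i.e. `Q_𝔭 = 0` pointwise for every prime `𝔭` of height `≤ 2`) is
zero, then every pseudo-null submodule of `X` is zero.  Proof: the image `Q` of the largest
pseudo-null submodule `N₀` in `X/ℓX` is supported in height `≥ 3`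
(`exists_smul_eq_zero_of_height_le_two` at `𝔭 ∋ ℓ`, and `ℓ ∉ 𝔭` kills `Q` outright), so
`Q = 0`, `N₀ ≤ ℓX`, and `N₀ = ℓ N₀` by `mem_of_smul_mem_of_forall_le`; Nakayama.
(Bourbaki AC VII §4.4; NSW (5.1.4).) [folklore] -/
theorem eq_bot_of_isPseudoNull_of_regular [Module.Finite R X] {ℓ : R}
    (hℓjac : ℓ ∈ (⊥ : Ideal R).jacobson) (hℓ : ∀ x : X, ℓ • x = 0 → x = 0)
    (hq : ∀ Q : Submodule R (QuotSMulTop ℓ X),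
      (∀ 𝔭 : PrimeSpectrum R, 𝔭.asIdeal.height ≤ 2 → ∀ q ∈ Q, ∃ r ∉ 𝔭.asIdeal, r • q = 0) →
        Q = ⊥)
    (N : Submodule R X) (hN : Module.IsPseudoNull R N) : N = ⊥ := by
  haveI : IsNoetherian R X := isNoetherian_of_isNoetherianRing_of_finite R X
  obtain ⟨N₀, hN₀, hmax⟩ := exists_isPseudoNull_forall_le (R := R) (X := X)
  suffices h0 : N₀ = ⊥ from le_bot_iff.mp (h0 ▸ hmax N hN)
  -- the image `Q` of `N₀` in `X/ℓX` vanishes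
  have hQ : N₀.map (ℓ • (⊤ : Submodule R X)).mkQ = ⊥ := by
    refine hq _ fun 𝔭 h𝔭 q hq' ↦ ?_
    obtain ⟨n, hn, rfl⟩ := Submodule.mem_map.mp hq'
    by_cases hℓ𝔭 : ℓ ∈ 𝔭.asIdeal
    · obtain ⟨r, hr, h0⟩ := exists_smul_eq_zero_of_height_le_two hℓ hN₀ h𝔭 hℓ𝔭 n hn
      exact ⟨r, hr, by rw [← map_smul, h0, map_zero]⟩
    · refine ⟨ℓ, hℓ𝔭, ?_⟩
      rw [← map_smul, Submodule.mkQ_apply, Submodule.Quotient.mk_eq_zero]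
      exact Submodule.smul_mem_pointwise_smul n ℓ ⊤ trivial
  -- hence `N₀ ≤ ℓ N₀`
  have hle : N₀ ≤ Ideal.span {ℓ} • N₀ := by
    intro n hn
    have hmem : (ℓ • (⊤ : Submodule R X)).mkQ n ∈ N₀.map (ℓ • (⊤ : Submodule R X)).mkQ :=
      Submodule.mem_map_of_mem hn
    rw [hQ, Submodule.mem_bot, Submodule.mkQ_apply, Submodule.Quotient.mk_eq_zero] at hmem
    obtain ⟨x, -, rfl⟩ := (Submodule.mem_smul_pointwise_iff_exists n ℓ ⊤).mp hmem
    exact Submodule.smul_mem_smul (Ideal.mem_span_singleton_self ℓ)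
      (mem_of_smul_mem_of_forall_le hℓ hN₀ hmax hn)
  exact Submodule.eq_bot_of_le_smul_of_le_jacobson_bot _ _ (IsNoetherian.noetherian N₀) hle
    ((Ideal.span_singleton_le_iff_mem _).mpr hℓjac)

end Generic

/-! ## §4. The two-variable Iwasawa algebra `Λ₂ = ℤ_p⟦T₂⟧⟦T₁⟧` -/

section LambdaTwo

variable (p : ℕ) [Fact p.Prime]

/-- `dim Λ₂ = 3` in the `IwasawaAlgebra₂` spelling (re-export of the tree's
`IwasawaTwoVariable.ringKrullDim_lambda₂`). [folklore] -/
theorem ringKrullDim_iwasawaAlgebra₂ : ringKrullDim (IwasawaAlgebra₂ p) = 3 :=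
  IwasawaTwoVariable.ringKrullDim_lambda₂ p

/-- A prime of `Λ₂` other than `𝔪 = (p, T₁, T₂)` has height `≤ 2`: it lies strictly below `𝔪`,
whose height is at most `dim Λ₂ = 3`. [folklore] -/
theorem height_le_two_of_ne_maximalIdeal (𝔮 : Ideal (IwasawaAlgebra₂ p)) [𝔮.IsPrime]
    (h𝔮 : 𝔮 ≠ maximalIdeal (IwasawaAlgebra₂ p)) : 𝔮.height ≤ 2 := by
  have hlt : 𝔮 < maximalIdeal (IwasawaAlgebra₂ p) :=
    lt_of_le_of_ne (le_maximalIdeal Ideal.IsPrime.ne_top') h𝔮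
  have h1 := Ideal.height_add_one_le_of_lt_of_isPrime hlt
  have h2 : ((maximalIdeal (IwasawaAlgebra₂ p)).height : WithBot ℕ∞) ≤ 3 :=
    ringKrullDim_iwasawaAlgebra₂ p ▸ Ideal.height_le_ringKrullDim_of_isPrime
  have h3 : (maximalIdeal (IwasawaAlgebra₂ p)).height ≤ 3 := by
    rw [show (3 : WithBot ℕ∞) = ((3 : ℕ∞) : WithBot ℕ∞) from rfl] at h2
    exact WithBot.coe_le_coe.1 h2
  have h4 : 𝔮.height + 1 ≤ 2 + 1 := h1.trans h3
  exact (WithTop.add_le_add_iff_right WithTop.one_ne_top).1 h4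

/-- The residue field `Λ₂/𝔪 ≅ 𝔽ₚ` is finite: `𝔪` is the kernel of the surjection
`Λ₂ → Λ → ℤₚ → ℤ/p` (two constant coefficients, then reduction mod `p`). [folklore] -/
theorem finite_quotient_maximalIdeal₂ :
    Finite (IwasawaAlgebra₂ p ⧸ maximalIdeal (IwasawaAlgebra₂ p)) := by
  let f : IwasawaAlgebra₂ p →+* ZMod p :=
    ((PadicInt.toZMod (p := p)).comp (PowerSeries.constantCoeff (R := ℤ_[p]))).comp
      (PowerSeries.constantCoeff (R := IwasawaAlgebra p))
  have hf : Function.Surjective f := ZMod.ringHom_surjective f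
  have hker : RingHom.ker f = maximalIdeal (IwasawaAlgebra₂ p) :=
    eq_maximalIdeal (RingHom.ker_isMaximal_of_surjective f hf)
  rw [← hker]
  exact Finite.of_equiv _ (RingHom.quotientKerEquivOfSurjective hf).symm.toEquiv

/-- `Λ₂/𝔪ⁿ` is finite for every `n`. [folklore] -/
theorem finite_quotient_maximalIdeal₂_pow (n : ℕ) :
    Finite (IwasawaAlgebra₂ p ⧸ maximalIdeal (IwasawaAlgebra₂ p) ^ n) :=
  haveI := finite_quotient_maximalIdeal₂ p
  Ideal.finite_quotient_pow (IsNoetherian.noetherian _) n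

/-- **A finitely generated `Λ₂`-module supported at `𝔪` only is finite**: if `M_𝔭 = 0`
(pointwise) for every prime `𝔭` of height `≤ 2`, i.e. for every prime `≠ 𝔪`, then `𝔪 ≤ √Ann M`,
`𝔪ⁿ M = 0`, and `M` is finitely generated over the finite ring `Λ₂/𝔪ⁿ`.
(NSW (5.1.4) Remark 4, one dimension up.) [folklore] -/
theorem finite_of_forall_height_le_two (M : Type*) [AddCommGroup M] [Module (IwasawaAlgebra₂ p) M]
    [Module.Finite (IwasawaAlgebra₂ p) M]
    (hM : ∀ 𝔭 : PrimeSpectrum (IwasawaAlgebra₂ p), 𝔭.asIdeal.height ≤ 2 →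
      ∀ m : M, ∃ r ∉ 𝔭.asIdeal, r • m = 0) :
    Finite M := by
  set 𝔪 := maximalIdeal (IwasawaAlgebra₂ p) with h𝔪def
  have hrad : 𝔪 ≤ (Module.annihilator (IwasawaAlgebra₂ p) M).radical := by
    rw [Ideal.radical_eq_sInf]
    refine le_sInf ?_
    rintro 𝔮 ⟨h𝔮ann, h𝔮⟩
    by_contra hne
    have hne' : 𝔮 ≠ 𝔪 := fun h => hne (h ▸ le_rfl)
    have hht := height_le_two_of_ne_maximalIdeal p 𝔮 hne'
    have hsub : Subsingleton (LocalizedModule 𝔮.primeCompl M) := by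
      rw [LocalizedModule.subsingleton_iff]
      exact hM ⟨𝔮, h𝔮⟩ hht
    have hmem : (⟨𝔮, h𝔮⟩ : PrimeSpectrum (IwasawaAlgebra₂ p)) ∈
        Module.support (IwasawaAlgebra₂ p) M :=
      Module.mem_support_iff_of_finite.2 h𝔮ann
    exact Module.notMem_support_iff.2 hsub hmem
  obtain ⟨n, hn⟩ :=
    Ideal.exists_pow_le_of_le_radical_of_fg hrad (IsNoetherian.noetherian 𝔪)
  have htors : Module.IsTorsionBySet (IwasawaAlgebra₂ p) M ↑(𝔪 ^ n) :=
    (Module.isTorsionBySet_iff_subset_annihilator _ _).2 hn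
  letI := htors.module
  haveI : IsScalarTower (IwasawaAlgebra₂ p) (IwasawaAlgebra₂ p ⧸ 𝔪 ^ n) M := htors.isScalarTower
  haveI : Module.Finite (IwasawaAlgebra₂ p ⧸ 𝔪 ^ n) M :=
    Module.Finite.of_restrictScalars_finite (IwasawaAlgebra₂ p) _ _
  haveI := finite_quotient_maximalIdeal₂_pow p n
  exact Module.finite_of_finite (IwasawaAlgebra₂ p ⧸ 𝔪 ^ n)

variable (X : Type*) [AddCommGroup X] [Module (IwasawaAlgebra₂ p) X]

/-- **No pseudo-null submodule from one line, over `Λ₂`.** `X` finitely generated over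
`Λ₂ = ℤ_p⟦T₂⟧⟦T₁⟧`, `ℓ ∈ 𝔪` (any "line") with (REG) `ℓ` `X`-regular and (NF) `X ⧸ ℓX` without
non-zero finite `Λ₂`-submodule ⟹ every pseudo-null `Λ₂`-submodule of `X` is `⊥`
(`eq_bot_of_isPseudoNull_of_regular` + `finite_of_forall_height_le_two`).
(Bourbaki AC VII §4.4; NSW (5.1.4).) [folklore] -/
theorem noPseudoNull_of_regular_of_noFiniteSubmodule [Module.Finite (IwasawaAlgebra₂ p) X]
    {ℓ : IwasawaAlgebra₂ p} (hℓ𝔪 : ℓ ∈ maximalIdeal (IwasawaAlgebra₂ p))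
    (hℓ : ∀ x : X, ℓ • x = 0 → x = 0)
    (hfin : ∀ Q : Submodule (IwasawaAlgebra₂ p) (QuotSMulTop ℓ X), Finite Q → Q = ⊥) :
    ∀ N : Submodule (IwasawaAlgebra₂ p) X,
      Module.IsPseudoNull (IwasawaAlgebra₂ p) N → N = ⊥ := by
  intro N hN
  haveI : IsNoetherian (IwasawaAlgebra₂ p) (QuotSMulTop ℓ X) :=
    isNoetherian_of_isNoetherianRing_of_finite _ _
  refine eq_bot_of_isPseudoNull_of_regular ?_ hℓ (fun Q hQ ↦ hfin Q ?_) N hN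
  · rwa [IsLocalRing.jacobson_eq_maximalIdeal ⊥ bot_ne_top]
  · exact finite_of_forall_height_le_two p Q fun 𝔭 h𝔭 q ↦ by
      obtain ⟨r, hr, h0⟩ := hQ 𝔭 h𝔭 q q.2
      exact ⟨r, hr, Subtype.ext (by simpa using h0)⟩

/-- The outer variable `T₁ = PowerSeries.X` lies in the maximal ideal of `Λ₂`. [folklore] -/
theorem X_mem_maximalIdeal : (PowerSeries.X : IwasawaAlgebra₂ p) ∈ maximalIdeal (IwasawaAlgebra₂ p) := by
  rw [mem_maximalIdeal, mem_nonunits_iff, PowerSeries.isUnit_iff_constantCoeff]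
  simp

/-- The inner variable `T₂ = C (PowerSeries.X)` lies in the maximal ideal of `Λ₂`. [folklore] -/
theorem CX_mem_maximalIdeal :
    (PowerSeries.C (PowerSeries.X : IwasawaAlgebra p) : IwasawaAlgebra₂ p) ∈
      maximalIdeal (IwasawaAlgebra₂ p) := by
  rw [mem_maximalIdeal, mem_nonunits_iff, PowerSeries.isUnit_iff_constantCoeff,
    PowerSeries.constantCoeff_C, PowerSeries.isUnit_iff_constantCoeff]
  simp

/-- **S3n ⟸ (REG) ∧ (NF) along the OUTER variable `T₁`** (the skeleton's descent `Λ₂ → Λ = Λ₂/T₁`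
to the adapted line, -w4 g10's `QuotSMulTop (PowerSeries.X) X` spelling): for a finitely generated
`Λ₂`-module `X` with `X[T₁] = 0` and `X/T₁X` free of non-zero finite submodules, every pseudo-null
`Λ₂`-submodule of `X` is `⊥` — the conclusion of `stub_noPseudoNull_two` for `X = D.X`.
(Bourbaki AC VII §4.4; NSW (5.1.4).) [folklore] -/
theorem noPseudoNull_of_X_regular_of_noFiniteSubmodule [Module.Finite (IwasawaAlgebra₂ p) X]
    (hX : ∀ x : X, (PowerSeries.X : IwasawaAlgebra₂ p) • x = 0 → x = 0)
    (hfin : ∀ Q : Submodule (IwasawaAlgebra₂ p)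
      (QuotSMulTop (PowerSeries.X : IwasawaAlgebra₂ p) X), Finite Q → Q = ⊥) :
    ∀ N : Submodule (IwasawaAlgebra₂ p) X,
      Module.IsPseudoNull (IwasawaAlgebra₂ p) N → N = ⊥ :=
  noPseudoNull_of_regular_of_noFiniteSubmodule p X (X_mem_maximalIdeal p) hX hfin

/-- **S3n ⟸ (REG) ∧ (NF) along the INNER variable `T₂ = C T₁`** (the other line convention, line in
the first slot of the generator pair): `X[T₂] = 0` and `X/T₂X` free of non-zero finite submodules
⟹ every pseudo-null `Λ₂`-submodule of `X` is `⊥`. (Bourbaki AC VII §4.4; NSW (5.1.4).) [folklore] -/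
theorem noPseudoNull_of_CX_regular_of_noFiniteSubmodule [Module.Finite (IwasawaAlgebra₂ p) X]
    (hX : ∀ x : X, (PowerSeries.C (PowerSeries.X : IwasawaAlgebra p) : IwasawaAlgebra₂ p) • x = 0 →
      x = 0)
    (hfin : ∀ Q : Submodule (IwasawaAlgebra₂ p)
      (QuotSMulTop (PowerSeries.C (PowerSeries.X : IwasawaAlgebra p) : IwasawaAlgebra₂ p) X),
        Finite Q → Q = ⊥) :
    ∀ N : Submodule (IwasawaAlgebra₂ p) X,
      Module.IsPseudoNull (IwasawaAlgebra₂ p) N → N = ⊥ :=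
  noPseudoNull_of_regular_of_noFiniteSubmodule p X (CX_mem_maximalIdeal p) hX hfin

end LambdaTwo

end Summit.BirchSwinnertonDyer.BirchSwinnertonDyer.Theorems.PrintCf2.NoPseudoNullOfLine

end
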